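import Summits.QuantumFields.YangMills.Theorems.UV3BranchExpansionGuardedTower
import Summits.QuantumFields.YangMills.Theorems.UV3BranchExpansionStackedActivity
import HarnessLib

/-!
# R3 (cell `ym3-torus`, YM₃ on T³ — a ladder RUNG, NOT d = 4, NOT infinite volume, NOT a mass gap, NOT the Clay problem) —
# **(F-TOP-hw) THE WEIGHT HALF OF THE BRANCH-EXPANSION SOCKET: the binder `hw` of ✓`UV3BranchExpansionGuardedTower.map_iterFrom_le_smul_of_branchExpansion`
# with `ν := dU_{j+n}` and `w s := (K·q)^{|s|}`, DISCHARGED from the stacked activity (A₃-concrete) under (H_K) and the per-level admitting bound `q`**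

Width seat `ym-ust-19936-w8` g12 on crux `stmt-QuantumFields-19936` `UnitScaleTilt.HistoryTailL` (`--supports`, helper; THEOREMS ONLY, 0 `def`, 0 `sorry`).
LEAD ★w1 g12's note `Cruxes/HistoryTailL/HTopBranchExpansion.md` (A)+(E): the socket ✓p760591 asks, for every history `s` outside the mute class and every `s′ ⊆ s`,
`dU_j((⋂_{τ∈s} {Small ℰ (V s′ τ.1 ·) τ.2}) ∩ (V s′ n)⁻¹B) ≤ w s · ν B`.  This file supplies it with `ν = dU_{j+n}`, `w s = (K·q)^{|s|}` (`x = K·q` of the note) from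
✓`UV3BranchExpansionStackedActivity.map_restrict_traj_le_pow_smul` (p759292), including the ADAPTER the LEAD booked for (F-TOP): (a) the level slices of a history
`s : Finset (Σ i : Fin n, PBond P (j+i+1))`; (b) the socket's recursion, stated for `i < n` only, extended to a global one by a term-level `Nat.rec` trajectory that agrees
with `V s′` up to height `n` (no `def`); (c) `⋂_{τ∈s} {…} = {∀ i < n, ∀ c ∈ slice i, …}`; (d) `Π_{i<n} K^{|slice′ i|} q^{|slice i|} ≤ (K·q)^{Σ_i |slice i|} = (K·q)^{|s|}`
(`K ≥ 1`, `Finset.card_sigma`).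
RECORD CURRENCY (★★OWNER WORDS 84 (2) ∕ 85 (4) ∕ ACK 145): record-independent kinematics of product Haar and the guarded averaging; SUPPLY-side for the hTop-class rows
`fibre55Win` ∕ `fibre57LowOn` of the χ record inside NODE O B3 and for Track A's N08 — NOT a 19936 registry row.

CONTENTS.  `exists_slices` (slices with their two defining equations) · `card_eq_sum_card_slices` · `exists_global_traj` (the `Nat.rec` extension and its agreement with `V s′`) ·
★★★ `hw_of_stackedActivity` (the `hw` binder of ✓p760591, letters verbatim).

HONEST SCOPE.  Bookkeeping over ✓p759292 ∕ ✓p760591 BY NAME; (H_K) and `q` are HYPOTHESES (✓`…GuardCoreLawSU2` at N = 2; ✓`…GuardAdmitting.measure_forall_guardAdmitting_le`);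
`hM` ((F-M2)) and the prefactor count ((C′)) are NOT here; nothing of hTop ∕ (T8) ∕ (O‴χₛ) ∕ `HistoryTailL` (19936) ∕ the rung ∕ d = 4 ∕ a mass gap ∕ Clay is proved.
YM₃ on T³ is rung R3 of the ladder, not the Clay problem.

References: T. Bałaban, Commun. Math. Phys. **109** (1987) 249–301 [Balaban1987RG1] ((0.4) p. 253); T. Bałaban, Commun. Math. Phys. **102** (1985) 255–275
[Balaban1985UV3] ((2) p. 256, the k-fold transport); T. Bałaban, Commun. Math. Phys. **98** (1985) 17–51 [Balaban1985Averaging] ((10) p. 19).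
-/

set_option autoImplicit false

noncomputable section

open MeasureTheory Set Function
open scoped ENNReal

namespace Summit.QuantumFields.YangMills.Theorems.UV3BranchExpansionSocketWeights

open Literature.MathematicalPhysics.QuantumFieldTheory.Balaban1983to89
open Literature.MathematicalPhysics.QuantumFieldTheory.Balaban1983to89.AveragingRT (axialAvg)
open Literature.MathematicalPhysics.QuantumFieldTheory.Balaban1983to89.BlockAveraging (Small avgFun)
open Literature.MathematicalPhysics.QuantumFieldTheory.Balaban1983to89.BlockAveragingHaarAC (centralBond)
open Summit.QuantumFields.YangMills.Theorems.UV3BranchExpansionStackedActivity (map_restrict_traj_le_pow_smul measurable_traj)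

/-! ## §1 Slices of a history and the global trajectory -/
section Slices

variable {P : Params} {j : ℕ} (n : ℕ)

/-- **THE LEVEL SLICES OF A HISTORY** (no `def`: an existential with the two defining equations): `slice i = {c | ⟨⟨i, _⟩, c⟩ ∈ s}` for `i < n` and `∅` above. [folklore] -/
theorem exists_slices (s : Finset (Σ i : Fin n, PBond P (j + i + 1))) :
    ∃ sl : (i : ℕ) → Finset (PBond P (j + i + 1)),
      (∀ (i : ℕ) (hi : i < n), sl i = Finset.univ.filter fun c => (⟨⟨i, hi⟩, c⟩ : Σ i : Fin n, PBond P (j + i + 1)) ∈ s) ∧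
      (∀ i, n ≤ i → sl i = ∅) := by
  classical
  exact ⟨fun i => if hi : i < n then Finset.univ.filter fun c => (⟨⟨i, hi⟩, c⟩ : Σ i : Fin n, PBond P (j + i + 1)) ∈ s else ∅,
    fun i hi => dif_pos hi, fun i hi => dif_neg (not_lt.2 hi)⟩

/-- **THE SLICES PARTITION THE HISTORY**: `|s| = Σ_{i<n} |slice i|` (`Finset.card_sigma`). [folklore] -/
theorem card_eq_sum_card_slices (s : Finset (Σ i : Fin n, PBond P (j + i + 1))) (sl : (i : ℕ) → Finset (PBond P (j + i + 1)))
    (hsl : ∀ (i : ℕ) (hi : i < n), sl i = Finset.univ.filter fun c => (⟨⟨i, hi⟩, c⟩ : Σ i : Fin n, PBond P (j + i + 1)) ∈ s) :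
    s.card = ∑ i ∈ Finset.range n, (sl i).card := by
  classical
  have hsig : s = (Finset.univ : Finset (Fin n)).sigma fun i => Finset.univ.filter fun c => (⟨i, c⟩ : Σ i : Fin n, PBond P (j + i + 1)) ∈ s := by
    ext ⟨i, c⟩
    simp only [Finset.mem_sigma, Finset.mem_univ, Finset.mem_filter, true_and]
  rw [hsig, Finset.card_sigma, ← Fin.sum_univ_eq_sum_range (fun i => (sl i).card) n]
  refine Finset.sum_congr rfl fun i _ => ?_
  rw [hsl i i.isLt]

end Slices

section Traj

variable {P : Params} {j : ℕ} {G : Type*} [GaugeGroup G] (ℰ : LoopAverage G) (n : ℕ)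

/-- **THE GLOBAL TRAJECTORY OF THE SLICES** (term-level recursion, no `def`): a trajectory satisfying the hybrid recursion at EVERY height, which agrees up to height `n` with any
trajectory satisfying the socket's recursion (stated for `i < n`) on the same slices. [folklore] -/
theorem exists_global_traj (sl' : (i : ℕ) → Finset (PBond P (j + i + 1)))
    (Vs : (i : ℕ) → GaugeField P j G → GaugeField P (j + i) G) (hV0 : ∀ U, Vs 0 U = U)
    (hVs : ∀ (i : ℕ), i < n → ∀ U, Vs (i + 1) U = (fun c => if c ∈ sl' i then avgFun ℰ (Vs i U) c else axialAvg (Vs i U) c : GaugeField P (j + i + 1) G)) :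
    ∃ W : (i : ℕ) → GaugeField P j G → GaugeField P (j + i) G,
      (∀ U, W 0 U = U) ∧
      (∀ i U, W (i + 1) U = (fun c => if c ∈ sl' i then avgFun ℰ (W i U) c else axialAvg (W i U) c : GaugeField P (j + i + 1) G)) ∧
      (∀ i, i ≤ n → ∀ U, W i U = Vs i U) := by
  refine ⟨fun i => @Nat.rec (fun i => GaugeField P j G → GaugeField P (j + i) G) (fun U => U)
      (fun i ih => fun U => (fun c => if c ∈ sl' i then avgFun ℰ (ih U) c else axialAvg (ih U) c : GaugeField P (j + i + 1) G)) i,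
    fun U => rfl, fun i U => rfl, ?_⟩
  intro i
  induction i with
  | zero => intro _ U; exact (hV0 U).symm
  | succ i ih =>
    intro hi U
    have hi' : i < n := Nat.lt_of_succ_le hi
    rw [hVs i hi' U, ← ih hi'.le U]

end Traj

/-! ## §2 The weight binder of the socket -/
section Weights

variable {P : Params} {j : ℕ} {G : Type*} [GaugeGroup G] (ℰ : LoopAverage G) (n : ℕ) [MeasurableSpace G] [RegularGaugeGroup G] [HaarData G]
  (V : Finset (Σ i : Fin n, PBond P (j + i + 1)) → (i : ℕ) → GaugeField P j G → GaugeField P (j + i) G)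

/-- ★★★ **(F-TOP-hw) THE WEIGHT BINDER `hw` OF ✓`map_iterFrom_le_smul_of_branchExpansion`, DISCHARGED**: hybrid trajectories `V s` in the socket's letters (recursion for
`i < n`), standing range `j + n ≤ m + K`, a constant `K ∈ [1, ∞)` dominating print's fibre laws on admitting backgrounds at every level `j + i`, `i < n` ((H_K)), and a
per-level admitting bound `dU_{j+i}(Adm_S) ≤ q^{|S|}`.  Then for all histories `s′ ⊆ s` and every measurable `B`,
`dU_j((⋂_{τ∈s} {U | Small ℰ (V s′ τ.1 U) τ.2}) ∩ (V s′ n)⁻¹ B) ≤ (K·q)^{|s|} · dU_{j+n}(B)` — the branch `(𝐬, 𝐬′)` weighs at most `x^{|𝐬|}`, `x = K·q`.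
[cite: Balaban1987RG1, (0.4) p.253; Balaban1985UV3, (2) p.256] -/
theorem hw_of_stackedActivity (hE : ∀ m, Measurable fun W : Fin (m + 1) → G => ℰ.E W)
    (hV0 : ∀ s U, V s 0 U = U)
    (hVs : ∀ s (i : ℕ) (hi : i < n) U, V s (i + 1) U = fun c =>
      if c ∈ (Finset.univ.filter fun c' => (⟨⟨i, hi⟩, c'⟩ : Σ i : Fin n, PBond P (j + i + 1)) ∈ s) then avgFun ℰ (V s i U) c else axialAvg (V s i U) c)
    (hn : j + n ≤ P.m + P.K) {K : ℝ≥0∞} (hK1 : 1 ≤ K) (hKtop : K ≠ ∞)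
    (hK : ∀ i, i < n → ∀ (c : PBond P (j + i + 1)) (U : GaugeField P (j + i) G), (∃ g : G, Small ℰ (update U (centralBond c) g) c) →
      (HaarData.haar : Measure G).map (fun g => avgFun ℰ (update U (centralBond c) g) c) ≤ K • (HaarData.haar : Measure G))
    (q : ℝ≥0∞) (hq : ∀ i, i < n → ∀ S : Finset (PBond P (j + i + 1)),
      fieldMeasure P (j + i) G {U : GaugeField P (j + i) G | ∀ c ∈ S, ∃ g : G, Small ℰ (update U (centralBond c) g) c} ≤ q ^ S.card) :
    ∀ s s' : Finset (Σ i : Fin n, PBond P (j + i + 1)), s' ⊆ s → ∀ B : Set (GaugeField P (j + n) G), MeasurableSet B →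
      fieldMeasure P j G ((⋂ τ ∈ s, {U : GaugeField P j G | Small ℰ (V s' τ.1 U) τ.2}) ∩ V s' n ⁻¹' B) ≤
        (K * q) ^ s.card * fieldMeasure P (j + n) G B := by
  classical
  intro s s' hs' B hB
  -- (a) slices
  obtain ⟨sl, hsl, hsl_ge⟩ := exists_slices n s
  obtain ⟨sl', hsl', hsl'_ge⟩ := exists_slices n s'
  have hsub : ∀ i, sl' i ⊆ sl i := by
    intro i
    by_cases hi : i < n
    · rw [hsl i hi, hsl' i hi]
      intro c hc
      simp only [Finset.mem_filter, Finset.mem_univ, true_and] at hc ⊢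
      exact hs' hc
    · rw [hsl'_ge i (not_lt.1 hi)]; exact Finset.empty_subset _
  -- (b) the global trajectory of the slices of `s'`, agreeing with `V s'` up to `n`
  have hVs' : ∀ (i : ℕ), i < n → ∀ U, V s' (i + 1) U =
      (fun c => if c ∈ sl' i then avgFun ℰ (V s' i U) c else axialAvg (V s' i U) c : GaugeField P (j + i + 1) G) := by
    intro i hi U
    rw [hVs s' i hi U, hsl' i hi]
  obtain ⟨W, hW0, hWs, hWV⟩ := exists_global_traj ℰ n sl' (V s') (hV0 s') hVs'
  have hWm : ∀ i, Measurable (W i) := measurable_traj ℰ hE sl' W hW0 hWs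
  -- the stacked activity for `W`
  have hK' : ∀ i, ∀ c ∈ sl' i, ∀ U : GaugeField P (j + i) G, (∃ g : G, Small ℰ (update U (centralBond c) g) c) →
      (HaarData.haar : Measure G).map (fun g => avgFun ℰ (update U (centralBond c) g) c) ≤ K • (HaarData.haar : Measure G) := by
    intro i c hc U hadm
    by_cases hi : i < n
    · exact hK i hi c U hadm
    · rw [hsl'_ge i (not_lt.1 hi)] at hc; exact absurd hc (Finset.notMem_empty c)
  have hstack := map_restrict_traj_le_pow_smul ℰ hE n hn sl sl' hsub W hW0 hWs hK1 hKtop hK' q hq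
  -- (c) the event and the top map in the socket's letters
  have hWn : W n = V s' n := funext (hWV n le_rfl)
  have hevent : {U : GaugeField P j G | ∀ i < n, ∀ c ∈ sl i, Small ℰ (W i U) c} =
      ⋂ τ ∈ s, {U : GaugeField P j G | Small ℰ (V s' τ.1 U) τ.2} := by
    ext U
    simp only [mem_setOf_eq, mem_iInter]
    constructor
    · rintro h ⟨⟨i, hi⟩, c⟩ hτ
      have hc : c ∈ sl i := by rw [hsl i hi]; exact Finset.mem_filter.2 ⟨Finset.mem_univ _, hτ⟩
      have := h i hi c hc
      rwa [hWV i hi.le U] at this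
    · intro h i hi c hc
      rw [hsl i hi] at hc
      have hτ := (Finset.mem_filter.1 hc).2
      rw [hWV i hi.le U]
      exact h ⟨⟨i, hi⟩, c⟩ hτ
  have hLHS : fieldMeasure P j G ((⋂ τ ∈ s, {U : GaugeField P j G | Small ℰ (V s' τ.1 U) τ.2}) ∩ V s' n ⁻¹' B) =
      ((fieldMeasure P j G).restrict {U : GaugeField P j G | ∀ i < n, ∀ c ∈ sl i, Small ℰ (W i U) c}).map (W n) B := by
    rw [Measure.map_apply (hWm n) hB, Measure.restrict_apply ((hWm n) hB), hevent, hWn, inter_comm]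
  -- (d) the weight
  have hcard : s.card = ∑ i ∈ Finset.range n, (sl i).card := card_eq_sum_card_slices n s sl hsl
  have hprod : (∏ i ∈ Finset.range n, K ^ (sl' i).card * q ^ (sl i).card) ≤ (K * q) ^ s.card := by
    calc (∏ i ∈ Finset.range n, K ^ (sl' i).card * q ^ (sl i).card)
        ≤ ∏ i ∈ Finset.range n, K ^ (sl i).card * q ^ (sl i).card :=
          Finset.prod_le_prod' fun i _ => mul_le_mul' (pow_le_pow_right₀ hK1 (Finset.card_le_card (hsub i))) le_rfl
      _ = ∏ i ∈ Finset.range n, (K * q) ^ (sl i).card := Finset.prod_congr rfl fun i _ => (mul_pow K q _).symm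
      _ = (K * q) ^ s.card := by rw [Finset.prod_pow_eq_pow_sum, hcard]
  -- assembly
  rw [hLHS]
  have h := hstack B
  rw [Measure.smul_apply, smul_eq_mul] at h
  exact h.trans (mul_le_mul' hprod le_rfl)

end Weights

end Summit.QuantumFields.YangMills.Theorems.UV3BranchExpansionSocketWeights

end
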